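import Literature.Geometry.Riemannian.TwoPiCoreModel
import Literature.Geometry.Riemannian.CuspedHyperbolic
import Mathlib.Geometry.Manifold.ContMDiffMFDeriv
import HarnessLib

/-!
# The straightened chart of a rank-`3` torus cusp

Support file (everything proved; no named fact, no `sorry`) for the Gromov–Thurston `2π` theorem
`Literature.Geometry.Riemannian.gromovThurston_twoPi_four` (`CuspedHyperbolic.lean`). A torus
cusp `C : TorusCusp g 3` (Benedetti–Petronio 1992, Prop. D.3.12; Anderson 2006, §2.1) is a
`Λ`-periodic parametrisation `E3 × ℝ → X`; composing it with a slope frame `(u₀, u₁, u₂)`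
(`TwoPiCore.SlopeFrame`, `TwoPiCoreModel.lean`) gives the **straightened cusp chart**
`cuspChart C fr : E4 → X`, `q ↦ C (∑_{k<3} q_k u_k, q₃)`, in which

* the pulled-back metric is the diagonal hyperbolic cusp model
  `e^{-2t}(dy₀² + dy₁² + dy₂²) + dt²` (`val_mfderiv_cuspChart`; orthonormality of the frame),
  so the differential is injective (`injective_mfderiv_cuspChart`);
* the chart is smooth on the region `{q₃ > -ε}` (`contMDiffOn_cuspChart`), periodic under the
  straightened lattice vectors (`cuspChart_add_latShift`, `mfderiv_cuspChart_add_latShift`) and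
  injective modulo them (`exists_latShift_of_cuspChart_eq`);
* through `Lθ` (`SlopeFrame.thetaToY`) it is the cusp point of the filling relation:
  `cuspChart C fr (Lθ q) = C (x(θ), t)` (`cuspChart_thetaToY`).

## References

* R. Benedetti, C. Petronio, *Lectures on Hyperbolic Geometry* (1992), Prop. D.3.12.
  [BenedettiPetronio1992]
* M. T. Anderson, *Dehn filling and Einstein metrics in higher dimensions*, J. Differential Geom.
  73 (2006) 219–261, §2.1. [Anderson2006]
-/

noncomputable section

open Set Function Filter TopologicalSpace Bundle
open scoped Manifold ContDiff Topology InnerProductSpace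

namespace Literature.Geometry.Riemannian

open Literature.Geometry.Lorentzian Literature.Geometry.Lorentzian.MetricCoord TwoPiCore

variable {X : Type*} [TopologicalSpace X] [ChartedSpace E4 X] [IsManifold (𝓡 4) ∞ X]
  {g : PseudoRiemannianMetric (𝓡 4) ∞ E4 (TangentSpace (𝓡 4) : X → Type _)}

namespace TorusCusp

variable (C : TorusCusp g 3) {a : Fin 3 → E3} (fr : SlopeFrame a)

/-! ### Straightened coordinates `y ↦ (x, t)` -/

/-- The linear map `(y₀, y₁, y₂, t) ↦ (∑ y_k u_k, t)` from straightened coordinates to the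
cusp's `(x, t)`. [folklore] -/
def yToX (fr : SlopeFrame a) : E4 →L[ℝ] E3 × ℝ :=
  (∑ k : Fin 3, (pr (Fin.castSucc k)).smulRight (fr.u k)).prod (pr 3)

/-- The value of `yToX`. [folklore] -/
@[simp] theorem yToX_apply (q : E4) :
    yToX fr q = (∑ k : Fin 3, q (Fin.castSucc k) • fr.u k, q 3) := by
  simp [yToX]

/-- The straightened lattice shift `(⟨ℓ, u₀⟩, ⟨ℓ, u₁⟩, ⟨ℓ, u₂⟩, 0)` of a vector `ℓ ∈ E3`.
[folklore] -/
def latShift (fr : SlopeFrame a) (ℓ : E3) : E4 := mk4 ⟪ℓ, fr.u 0⟫_ℝ ⟪ℓ, fr.u 1⟫_ℝ ⟪ℓ, fr.u 2⟫_ℝ 0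

/-- `yToX` of a shifted point: the `x`-part is translated by `ℓ`. [folklore] -/
theorem yToX_add_latShift (q : E4) (ℓ : E3) :
    yToX fr (q + latShift fr ℓ) = ((yToX fr q).1 + ℓ, q 3) := by
  rw [yToX_apply, yToX_apply]
  refine Prod.ext ?_ (by simp [latShift])
  simp only
  have h : ∀ k : Fin 3, (q + latShift fr ℓ) (Fin.castSucc k) = q (Fin.castSucc k) + ⟪ℓ, fr.u k⟫_ℝ := by
    intro k
    fin_cases k <;> simp [latShift]
  simp_rw [h, add_smul, Finset.sum_add_distrib, fr.sum_inner_smul]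

/-! ### The chart -/

/-- **The straightened cusp chart** `q ↦ C (∑_{k<3} q_k u_k, q₃)`. [cite: Anderson2006, §2.1, (2.1)] -/
def cuspChart (C : TorusCusp g 3) (fr : SlopeFrame a) (q : E4) : X := C (yToX fr q)

/-- The region `{q₃ > -ε}` of the straightened chart is open. [folklore] -/
theorem isOpen_chartRegion : IsOpen {q : E4 | -C.eps < q 3} :=
  isOpen_lt continuous_const ((EuclideanSpace.proj (3 : Fin 4) : E4 →L[ℝ] ℝ).continuous)

/-- **The chart is smooth on the region `{q₃ > -ε}`.** [folklore] -/
theorem contMDiffOn_cuspChart :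
    ContMDiffOn 𝓘(ℝ, E4) (𝓡 4) ∞ (cuspChart C fr) {q : E4 | -C.eps < q 3} := by
  refine C.contMDiffOn.comp (yToX fr).contMDiff.contMDiffOn fun q hq ↦ ?_
  simpa using hq

/-- The chart is smooth at the points of the region. [folklore] -/
theorem contMDiffAt_cuspChart {q : E4} (hq : -C.eps < q 3) :
    ContMDiffAt 𝓘(ℝ, E4) (𝓡 4) ∞ (cuspChart C fr) q :=
  (contMDiffOn_cuspChart C fr).contMDiffAt (C.isOpen_chartRegion.mem_nhds hq)

/-- **Chain rule for the chart**: `d(cuspChart)_q = dC_{(x,t)} ∘ yToX`. [folklore] -/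
theorem mfderiv_cuspChart {q : E4} (hq : -C.eps < q 3) :
    mfderiv 𝓘(ℝ, E4) (𝓡 4) (cuspChart C fr) q =
      (mfderiv 𝓘(ℝ, E3 × ℝ) (𝓡 4) C (yToX fr q)).comp (yToX fr) := by
  have hC : MDifferentiableAt 𝓘(ℝ, E3 × ℝ) (𝓡 4) C (yToX fr q) := C.mdifferentiableAt (by simpa using hq)
  have hL : MDifferentiableAt 𝓘(ℝ, E4) 𝓘(ℝ, E3 × ℝ) (yToX fr) q := (yToX fr).mdifferentiableAt
  have h := mfderiv_comp q hC hL
  rw [ContinuousLinearMap.mfderiv_eq] at h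
  exact h

/-- **The chart pulls the metric back to the diagonal hyperbolic cusp model**:
`g(d cuspChart v, d cuspChart w) = e^{-2t} ∑_{k<3} v_k w_k + v₃ w₃` (the cusp isometry
`TorusCusp.isometric` and orthonormality of the frame). [cite: BenedettiPetronio1992, Prop. D.3.12] -/
theorem val_mfderiv_cuspChart {q : E4} (hq : -C.eps < q 3) (v w : E4) :
    g.val (cuspChart C fr q) (mfderiv 𝓘(ℝ, E4) (𝓡 4) (cuspChart C fr) q v)
      (mfderiv 𝓘(ℝ, E4) (𝓡 4) (cuspChart C fr) q w) =
      Real.exp (-2 * q 3) * (∑ k : Fin 3, v (Fin.castSucc k) * w (Fin.castSucc k)) + v 3 * w 3 := by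
  rw [mfderiv_cuspChart C fr hq]
  have h := C.isometric (yToX fr q) (by simpa using hq) (yToX fr v) (yToX fr w)
  rw [TorusCusp.toFun_eq_coe] at h
  change g.val (C (yToX fr q)) (mfderiv 𝓘(ℝ, E3 × ℝ) (𝓡 4) C (yToX fr q) (yToX fr v))
    (mfderiv 𝓘(ℝ, E3 × ℝ) (𝓡 4) C (yToX fr q) (yToX fr w)) = _
  rw [h]
  simp only [yToX_apply, fr.inner_sum_smul]

/-- The same, as the one-variable diagonal model `∑ cᵢ(t) vᵢ wᵢ` whenever the profile is
hyperbolic at height `t = q₃`: `c₀ = c₁ = c₂ = e^{-2t}`, `c₃ = 1`. [folklore] -/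
theorem val_mfderiv_cuspChart_eq_diagMetric {q : E4} (hq : -C.eps < q 3) {c : Fin 4 → ℝ → ℝ}
    (h0 : c 0 (q 3) = Real.exp (-2 * q 3)) (h1 : c 1 (q 3) = Real.exp (-2 * q 3))
    (h2 : c 2 (q 3) = Real.exp (-2 * q 3)) (h3 : c 3 (q 3) = 1) (v w : E4) :
    g.val (cuspChart C fr q) (mfderiv 𝓘(ℝ, E4) (𝓡 4) (cuspChart C fr) q v)
      (mfderiv 𝓘(ℝ, E4) (𝓡 4) (cuspChart C fr) q w) = diagMetric (oneVar c) q v w := by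
  rw [val_mfderiv_cuspChart C fr hq, diagMetric_apply, Fin.sum_univ_four, Fin.sum_univ_three]
  simp only [oneVar, h0, h1, h2, h3]
  simp only [Fin.castSucc_zero, Fin.castSucc_one, show Fin.castSucc (2 : Fin 3) = (2 : Fin 4) from rfl]
  ring

/-- A tangent vector killed by the differential of the chart is zero (the pulled-back form is
positive definite). [folklore] -/
theorem eq_zero_of_mfderiv_cuspChart_eq_zero {q : E4} (hq : -C.eps < q 3) {v : E4}
    (hv : mfderiv 𝓘(ℝ, E4) (𝓡 4) (cuspChart C fr) q v = 0) : v = 0 := by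
  have h := val_mfderiv_cuspChart C fr hq v v
  simp only [hv, map_zero] at h
  rw [Fin.sum_univ_three] at h
  have he := Real.exp_pos (-2 * q 3)
  have h0 := mul_self_nonneg (v (Fin.castSucc 0))
  have h1 := mul_self_nonneg (v (Fin.castSucc 1))
  have h2 := mul_self_nonneg (v (Fin.castSucc 2))
  have h3 := mul_self_nonneg (v 3)
  have hA := mul_nonneg he.le (add_nonneg (add_nonneg h0 h1) h2)
  have hsum1 : Real.exp (-2 * q 3) * (v (Fin.castSucc 0) * v (Fin.castSucc 0) +
      v (Fin.castSucc 1) * v (Fin.castSucc 1) + v (Fin.castSucc 2) * v (Fin.castSucc 2)) = 0 := by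
    linarith
  have hsum2 : v 3 * v 3 = 0 := by linarith
  have hin : v (Fin.castSucc 0) * v (Fin.castSucc 0) + v (Fin.castSucc 1) * v (Fin.castSucc 1) +
      v (Fin.castSucc 2) * v (Fin.castSucc 2) = 0 := (mul_eq_zero.1 hsum1).resolve_left he.ne'
  have e0 : v (Fin.castSucc 0) = 0 := mul_self_eq_zero.1 (by linarith)
  have e1 : v (Fin.castSucc 1) = 0 := mul_self_eq_zero.1 (by linarith)
  have e2 : v (Fin.castSucc 2) = 0 := mul_self_eq_zero.1 (by linarith)
  have e3 : v 3 = 0 := mul_self_eq_zero.1 hsum2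
  ext i
  fin_cases i
  · exact e0
  · exact e1
  · exact e2
  · exact e3

/-- **The differential of the chart is injective** on the region. [folklore] -/
theorem injective_mfderiv_cuspChart {q : E4} (hq : -C.eps < q 3) :
    Injective (mfderiv 𝓘(ℝ, E4) (𝓡 4) (cuspChart C fr) q) := fun v w hvw ↦ by
  rw [← sub_eq_zero]
  refine eq_zero_of_mfderiv_cuspChart_eq_zero C fr hq ?_
  rw [map_sub, hvw, sub_self]

/-! ### Periodicity -/

/-- **Periodicity of the chart** under straightened lattice vectors. [folklore] -/
theorem cuspChart_add_latShift {q : E4} (hq : -C.eps < q 3) {ℓ : E3} (hℓ : ℓ ∈ C.lattice) :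
    cuspChart C fr (q + latShift fr ℓ) = cuspChart C fr q := by
  unfold cuspChart
  rw [yToX_add_latShift, yToX_apply]
  exact C.apply_add_of_mem_lattice hℓ _ hq

/-- The shifted point lies in the region iff the point does (the height is unchanged). [folklore] -/
@[simp] theorem add_latShift_apply_three (q : E4) (ℓ : E3) : (q + latShift fr ℓ) 3 = q 3 := by
  simp [latShift]

/-- **The differential of the chart is periodic** under straightened lattice vectors (the chart
agrees near `q` with its composition with the translation, whose differential is the identity).
[folklore] -/
theorem mfderiv_cuspChart_add_latShift {q : E4} (hq : -C.eps < q 3) {ℓ : E3} (hℓ : ℓ ∈ C.lattice) :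
    mfderiv 𝓘(ℝ, E4) (𝓡 4) (cuspChart C fr) (q + latShift fr ℓ) =
      mfderiv 𝓘(ℝ, E4) (𝓡 4) (cuspChart C fr) q := by
  set s := latShift fr ℓ with hs
  have heq : cuspChart C fr =ᶠ[𝓝 q] (cuspChart C fr ∘ fun x : E4 ↦ x + s) := by
    filter_upwards [C.isOpen_chartRegion.mem_nhds hq] with x hx
    exact (cuspChart_add_latShift C fr hx hℓ).symm
  have htr : MDifferentiableAt 𝓘(ℝ, E4) 𝓘(ℝ, E4) (fun x : E4 ↦ x + s) q :=
    ((contDiff_id.add contDiff_const : ContDiff ℝ ∞ fun x : E4 ↦ x + s).contMDiff).mdifferentiableAt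
      (by simp)
  have hq' : -C.eps < (q + s) 3 := by rwa [hs, add_latShift_apply_three]
  have hC : MDifferentiableAt 𝓘(ℝ, E4) (𝓡 4) (cuspChart C fr) (q + s) :=
    (contMDiffAt_cuspChart C fr hq').mdifferentiableAt (by simp)
  rw [heq.mfderiv_eq, mfderiv_comp q hC htr, mfderiv_eq_fderiv, fderiv_add_const, fderiv_fun_id]
  ext v
  rfl

/-- **Injectivity of the chart modulo the lattice**: two points of the region with the same
image have the same height and differ by a straightened lattice vector
(`TorusCusp.eq_imp` and orthonormality of the frame). [folklore] -/
theorem exists_latShift_of_cuspChart_eq {q q' : E4} (hq : -C.eps < q 3) (hq' : -C.eps < q' 3)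
    (h : cuspChart C fr q = cuspChart C fr q') :
    ∃ ℓ ∈ C.lattice, q' = q + latShift fr ℓ := by
  unfold cuspChart at h
  rw [yToX_apply, yToX_apply] at h
  obtain ⟨ht, hx⟩ := C.eq_imp _ _ _ _ hq hq' h
  refine ⟨-(∑ k : Fin 3, q (Fin.castSucc k) • fr.u k - ∑ k : Fin 3, q' (Fin.castSucc k) • fr.u k),
    C.lattice.neg_mem hx, ?_⟩
  have hcoord : ∀ k : Fin 3, q' (Fin.castSucc k) = q (Fin.castSucc k) +
      ⟪-(∑ j : Fin 3, q (Fin.castSucc j) • fr.u j - ∑ j : Fin 3, q' (Fin.castSucc j) • fr.u j),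
        fr.u k⟫_ℝ := by
    intro k
    rw [inner_neg_left, inner_sub_left, fr.orthonormal.inner_left_fintype,
      fr.orthonormal.inner_left_fintype]
    simp
  ext i
  fin_cases i
  · simpa [latShift] using hcoord 0
  · simpa [latShift] using hcoord 1
  · simpa [latShift] using hcoord 2
  · simpa [latShift] using ht.symm

/-! ### Through `Lθ`: the cusp point of the filling relation -/

/-- **`cuspChart ∘ Lθ` is the cusp point**: `cuspChart C fr (Lθ q) = C (x(q), q₃)` with
`x(q) = (q₀ a₀ + q₁ a₁ + q₂ a₂)/2π` (`TwoPiCore.xTheta`). [cite: Anderson2006, §2.1, (2.2)] -/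
theorem cuspChart_thetaToY (q : E4) : cuspChart C fr (fr.thetaToY q) = C (xTheta a q, q 3) := by
  unfold cuspChart
  rw [yToX_apply, fr.sum_thetaToY_smul, fr.thetaToY_apply_three]

end TorusCusp

end Literature.Geometry.Riemannian
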